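import Summits.KontsevichZagierPeriods.KontsevichZagierPeriods.Theorems.HurwitzMicroSectorsNormalFormPrincipleM4SharedTools
import Literature.NumberTheory.Transcendental.KZProductIdeal

/-!
# `NormalFormPrinciple` (stmt-KontsevichZagierPeriods-3869), line `SketchIdeator1` —
# leaf `stub_boxRigidity`, layer `Island`: the carriers of the product island at height `q`

Pure proof file (registered stub `isl_carriers`, lead seat c9; `--supports` the crux). The
PRODUCT ISLAND at height `q` (`q : ℕ`, `2 ≤ q`) is the dimension-two layer of the leaf at the
non-special algebraic point `1/q`: its atoms are the boxes
`D = [□², 1/(q − x₀x₁)]` (`Li₂(1/q)`), `L = [□², 1/(q − x₀)]` (`ℓ = log(q/(q−1))`),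
`P = [□², 1/((q−x₀)(q−x₁))]` (`ℓ²`), `Vq = [□², q/((q−x₀)(q−x₀x₁))]` and its transpose,
`Tq = [□², q(q−1)/((q−x₀)(q−x₁)(q−x₀x₁))]`, `W = [□², x₀/((q−x₀)(q−x₀x₁))]`, `[□², 1/(q − x₁)]`,
`[□², 1]`, and the triangle `Tr = [Δ₂, 1/((q−t₀)(q−t₁))]` on `Δ₂ = {0 < t₁ < t₀ < 1}`.
This file supplies (no move of the calculus is needed here):

* EXISTENCE of all these integral representations, with the literal domains and integrands
  (as function equalities): for `q ≥ 2` every denominator is `≥ q − 1 ≥ 1` on the CLOSED square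
  `[0,1]²`, so each integrand is a quotient of `ℚ`-polynomials with nonvanishing denominator
  (`ℚ`-semialgebraic, `isSemialgebraicFunOn_aeval_div_aeval`), continuous and bounded on the
  compact square, hence absolutely integrable on any subset (`isl_carriers_exists_rep`);
* the VALUES the island's bookkeeping uses: `[□², 1] = 1` (volume of the box), and, by Fubini on
  the product box (`MeasureTheory.integral_fin_nat_prod_eq_prod`), `L = ∫₀¹ dt/(q − t)` and
  `P = (∫₀¹ dt/(q − t))²` (kept as integrals).

References: M. Kontsevich, D. Zagier, *Periods* (2001), §1.1–1.2. No definitions are introduced.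
-/

noncomputable section

open MeasureTheory Set
open MvPolynomial (X aeval)
open Literature.NumberTheory.Transcendental Literature.NumberTheory.Transcendental.KZ
open Literature.ModelTheory.ExponentialFields (IsSemialgebraic continuous_aeval_real)
open Summit.KontsevichZagierPeriods.HurwitzMicroSectors.NormalFormPrinciple.PiBox.M3
  (m4d_simplex2_eq_openOrderedSimplex)

namespace Summit.KontsevichZagierPeriods.HurwitzMicroSectors.NormalFormPrinciple.PiBox.Island

/-- **A rational integrand regular on the closed square carries a representation on any
semialgebraic part of it.** If `S ⊆ [0,1]²` is `ℚ`-semialgebraic and `f = p/r` with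
`p r ∈ ℚ[x₀, x₁]`, `r ≠ 0` on the closed square, then `[S, f]` is an integral representation:
`f` is `ℚ`-semialgebraic on `S`, continuous on the compact square, hence absolutely integrable
on `S`. [cite: KontsevichZagier2001, §1.1] -/
theorem isl_carriers_exists_rep {S : Set (Fin 2 → ℝ)} (hS : IsSemialgebraic ℚ S)
    (hSI : S ⊆ Set.Icc 0 1) (p r : MvPolynomial (Fin 2) ℚ) {f : (Fin 2 → ℝ) → ℝ}
    (hr : ∀ x ∈ Set.Icc (0 : Fin 2 → ℝ) 1, (aeval x r : ℝ) ≠ 0)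
    (hf : ∀ x, f x = (aeval x p : ℝ) / aeval x r) :
    ∃ N : IntegralRep 2, N.domain = S ∧ N.integrand = f := by
  have hsa : IsSemialgebraicFunOn ℚ S f :=
    (isSemialgebraicFunOn_aeval_div_aeval hS p r fun x hx => hr x (hSI hx)).congr
      fun x _ => (hf x).symm
  have hc : ContinuousOn f (Set.Icc (0 : Fin 2 → ℝ) 1) :=
    ((continuous_aeval_real p).continuousOn.div (continuous_aeval_real r).continuousOn hr).congr
      fun x _ => hf x
  exact ⟨⟨S, f, hS, hsa, (hc.integrableOn_compact isCompact_Icc).mono_set hSI⟩, rfl, rfl⟩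

/-- **The denominators of the island are positive on the closed square.** For `q ≥ 2` and
`x ∈ [0,1]²`: `0 < q − x₀`, `0 < q − x₁`, `0 < q − x₀x₁` (all three are `≥ q − 1 ≥ 1`).
[folklore] -/
theorem isl_carriers_den_pos {q : ℕ} (hq : 2 ≤ q) {x : Fin 2 → ℝ}
    (hx : x ∈ Set.Icc (0 : Fin 2 → ℝ) 1) :
    0 < (q:ℝ) - x 0 ∧ 0 < (q:ℝ) - x 1 ∧ 0 < (q:ℝ) - x 0 * x 1 := by
  have hq' : (2:ℝ) ≤ q := by exact_mod_cast hq
  have h0 : x 0 ≤ 1 := hx.2 0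
  have h1 : x 1 ≤ 1 := hx.2 1
  have h01 : x 0 * x 1 ≤ 1 := mul_le_one₀ h0 (hx.1 1) h1
  exact ⟨by linarith, by linarith, by linarith⟩

/-- **Registered stub `isl_carriers` (stmt-KontsevichZagierPeriods-3869, line `SketchIdeator1`,
layer `Island`).** The carriers of the product island at height `q ≥ 2`: (a) each of the nine box
integrands `q/((q−x₀)(q−x₀x₁))`, `q/((q−x₁)(q−x₀x₁))`, `1/(q−x₀x₁)`, `x₀/((q−x₀)(q−x₀x₁))`,
`1/((q−x₀)(q−x₁))`, `q(q−1)/((q−x₀)(q−x₁)(q−x₀x₁))`, `1/(q−x₀)`, `1/(q−x₁)`, `1` is the integrand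
of an integral representation on the open unit box `□²` (quotients of `ℚ`-polynomials whose
denominators are `≥ 1` on the closed square: bounded, continuous, absolutely integrable);
(b) so is `1/((q−t₀)(q−t₁))` on the triangle `Δ₂ = {0 < t₁ < t₀ < 1}`; (c) `[□², 1]` has value
`1`; (d) by Fubini on the product box, `[□², 1/(q−x₀)]` has value `∫₀¹ dt/(q−t)` and
`[□², 1/((q−x₀)(q−x₁))]` has value `(∫₀¹ dt/(q−t))²`. [cite: KontsevichZagier2001, §1.1] -/
theorem isl_carriers :
    ∀ (q : ℕ), 2 ≤ q →
      (∀ f : (Fin 2 → ℝ) → ℝ,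
        f ∈ ({fun x => (q:ℝ) / (((q:ℝ) - x 0) * ((q:ℝ) - x 0 * x 1)),
              fun x => (q:ℝ) / (((q:ℝ) - x 1) * ((q:ℝ) - x 0 * x 1)),
              fun x => 1 / ((q:ℝ) - x 0 * x 1),
              fun x => x 0 / (((q:ℝ) - x 0) * ((q:ℝ) - x 0 * x 1)),
              fun x => 1 / (((q:ℝ) - x 0) * ((q:ℝ) - x 1)),
              fun x => (q:ℝ) * ((q:ℝ) - 1) / (((q:ℝ) - x 0) * ((q:ℝ) - x 1) * ((q:ℝ) - x 0 * x 1)),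
              fun x => 1 / ((q:ℝ) - x 0),
              fun x => 1 / ((q:ℝ) - x 1),
              fun _ => (1:ℝ)} : Set ((Fin 2 → ℝ) → ℝ)) →
        ∃ N : IntegralRep 2, N.domain = {x | ∀ i, x i ∈ Set.Ioo (0:ℝ) 1} ∧ N.integrand = f) ∧
      (∃ Tr : IntegralRep 2, Tr.domain = {t | 0 < t 1 ∧ t 1 < t 0 ∧ t 0 < 1} ∧
        (Tr.integrand = fun t => 1 / (((q:ℝ) - t 0) * ((q:ℝ) - t 1)))) ∧
      (∀ ONE : IntegralRep 2, ONE.domain = {x | ∀ i, x i ∈ Set.Ioo (0:ℝ) 1} →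
        (ONE.integrand = fun _ => (1:ℝ)) → ONE.value = 1) ∧
      (∀ L P : IntegralRep 2, L.domain = {x | ∀ i, x i ∈ Set.Ioo (0:ℝ) 1} →
        (L.integrand = fun x => 1 / ((q:ℝ) - x 0)) →
        P.domain = {x | ∀ i, x i ∈ Set.Ioo (0:ℝ) 1} →
        (P.integrand = fun x => 1 / (((q:ℝ) - x 0) * ((q:ℝ) - x 1))) →
        L.value = (∫ t in Set.Ioo (0:ℝ) 1, 1 / ((q:ℝ) - t)) ∧
          P.value = (∫ t in Set.Ioo (0:ℝ) 1, 1 / ((q:ℝ) - t)) ^ 2) := by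
  intro q hq
  have hB := isSemialgebraic_box 2
  have hbox : {x : Fin 2 → ℝ | ∀ i, x i ∈ Set.Ioo (0:ℝ) 1} ⊆ Set.Icc 0 1 :=
    fun x hx => ⟨fun i => (hx i).1.le, fun i => (hx i).2.le⟩
  -- the height `q` as a `ℚ`-polynomial
  obtain ⟨Q, hQx⟩ : ∃ Q : MvPolynomial (Fin 2) ℚ, ∀ x : Fin 2 → ℝ, (aeval x Q : ℝ) = (q:ℝ) :=
    ⟨(q : MvPolynomial (Fin 2) ℚ), fun x => map_natCast (aeval x) q⟩
  refine ⟨fun f hf => ?_, ?_, fun ONE hd hi => ?_, fun L P hLd hLi hPd hPi => ⟨?_, ?_⟩⟩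
  · -- (a) the nine box carriers
    simp only [Set.mem_insert_iff, Set.mem_singleton_iff] at hf
    rcases hf with rfl | rfl | rfl | rfl | rfl | rfl | rfl | rfl | rfl
    · refine isl_carriers_exists_rep hB hbox Q ((Q - X 0) * (Q - X 0 * X 1))
        (fun x hx => ?_) fun x => ?_
      · obtain ⟨h0, -, h2⟩ := isl_carriers_den_pos hq hx
        simp only [map_mul, map_sub, hQx, MvPolynomial.aeval_X]
        exact (mul_pos h0 h2).ne'
      · simp only [map_mul, map_sub, hQx, MvPolynomial.aeval_X]
    · refine isl_carriers_exists_rep hB hbox Q ((Q - X 1) * (Q - X 0 * X 1))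
        (fun x hx => ?_) fun x => ?_
      · obtain ⟨-, h1, h2⟩ := isl_carriers_den_pos hq hx
        simp only [map_mul, map_sub, hQx, MvPolynomial.aeval_X]
        exact (mul_pos h1 h2).ne'
      · simp only [map_mul, map_sub, hQx, MvPolynomial.aeval_X]
    · refine isl_carriers_exists_rep hB hbox 1 (Q - X 0 * X 1) (fun x hx => ?_) fun x => ?_
      · obtain ⟨-, -, h2⟩ := isl_carriers_den_pos hq hx
        simp only [map_mul, map_sub, hQx, MvPolynomial.aeval_X]
        exact h2.ne'
      · simp only [map_one, map_mul, map_sub, hQx, MvPolynomial.aeval_X]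
    · refine isl_carriers_exists_rep hB hbox (X 0) ((Q - X 0) * (Q - X 0 * X 1))
        (fun x hx => ?_) fun x => ?_
      · obtain ⟨h0, -, h2⟩ := isl_carriers_den_pos hq hx
        simp only [map_mul, map_sub, hQx, MvPolynomial.aeval_X]
        exact (mul_pos h0 h2).ne'
      · simp only [map_mul, map_sub, hQx, MvPolynomial.aeval_X]
    · refine isl_carriers_exists_rep hB hbox 1 ((Q - X 0) * (Q - X 1)) (fun x hx => ?_) fun x => ?_
      · obtain ⟨h0, h1, -⟩ := isl_carriers_den_pos hq hx
        simp only [map_mul, map_sub, hQx, MvPolynomial.aeval_X]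
        exact (mul_pos h0 h1).ne'
      · simp only [map_one, map_mul, map_sub, hQx, MvPolynomial.aeval_X]
    · refine isl_carriers_exists_rep hB hbox (Q * (Q - 1)) ((Q - X 0) * (Q - X 1) * (Q - X 0 * X 1))
        (fun x hx => ?_) fun x => ?_
      · obtain ⟨h0, h1, h2⟩ := isl_carriers_den_pos hq hx
        simp only [map_mul, map_sub, hQx, MvPolynomial.aeval_X]
        exact (mul_pos (mul_pos h0 h1) h2).ne'
      · simp only [map_one, map_mul, map_sub, hQx, MvPolynomial.aeval_X]
    · refine isl_carriers_exists_rep hB hbox 1 (Q - X 0) (fun x hx => ?_) fun x => ?_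
      · obtain ⟨h0, -, -⟩ := isl_carriers_den_pos hq hx
        simp only [map_sub, hQx, MvPolynomial.aeval_X]
        exact h0.ne'
      · simp only [map_one, map_sub, hQx, MvPolynomial.aeval_X]
    · refine isl_carriers_exists_rep hB hbox 1 (Q - X 1) (fun x hx => ?_) fun x => ?_
      · obtain ⟨-, h1, -⟩ := isl_carriers_den_pos hq hx
        simp only [map_sub, hQx, MvPolynomial.aeval_X]
        exact h1.ne'
      · simp only [map_one, map_sub, hQx, MvPolynomial.aeval_X]
    · refine isl_carriers_exists_rep hB hbox 1 1 (fun x _ => ?_) fun x => ?_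
      · simp only [map_one]
        exact one_ne_zero
      · simp only [map_one, div_one]
  · -- (b) the triangle carrier
    have hΔ : IsSemialgebraic ℚ {t : Fin 2 → ℝ | 0 < t 1 ∧ t 1 < t 0 ∧ t 0 < 1} := by
      rw [m4d_simplex2_eq_openOrderedSimplex]
      exact isSemialgebraic_openOrderedSimplex 2
    have hΔI : {t : Fin 2 → ℝ | 0 < t 1 ∧ t 1 < t 0 ∧ t 0 < 1} ⊆ Set.Icc 0 1 := fun t ht => by
      simp only [Set.mem_Icc, Pi.le_def, Pi.zero_apply, Pi.one_apply, Fin.forall_fin_two]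
      exact ⟨⟨(ht.1.trans ht.2.1).le, ht.1.le⟩, ht.2.2.le, (ht.2.1.trans ht.2.2).le⟩
    refine isl_carriers_exists_rep hΔ hΔI 1 ((Q - X 0) * (Q - X 1)) (fun x hx => ?_) fun x => ?_
    · obtain ⟨h0, h1, -⟩ := isl_carriers_den_pos hq hx
      simp only [map_mul, map_sub, hQx, MvPolynomial.aeval_X]
      exact (mul_pos h0 h1).ne'
    · simp only [map_one, map_mul, map_sub, hQx, MvPolynomial.aeval_X]
  · -- (c) the value of `[□², 1]` is the volume of the box
    rw [IntegralRep.value, hd, hi]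
    beta_reduce
    rw [setIntegral_const, smul_eq_mul, mul_one, measureReal_def,
      Beukers.setOf_forall_mem_Ioo_eq_pi 2, volume_pi_pi]
    simp [Real.volume_Ioo]
  · -- (d) the value of `L` by Fubini on the product box
    rw [IntegralRep.value, hLd, hLi, Beukers.volume_restrict_cube 2]
    have h := integral_fin_nat_prod_eq_prod (𝕜 := ℝ)
      (μ := fun _ : Fin 2 => (volume : Measure ℝ).restrict (Set.Ioo (0:ℝ) 1))
      ![fun t => 1 / ((q:ℝ) - t), fun _ => (1:ℝ)]
    simp only [Fin.prod_univ_two, Matrix.cons_val_zero, Matrix.cons_val_one, mul_one] at h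
    rw [integral_const, measureReal_restrict_apply_univ, Real.volume_real_Ioo_of_le zero_le_one,
      sub_zero, one_smul, mul_one] at h
    beta_reduce
    exact h
  · -- (d) the value of `P` by Fubini on the product box
    rw [IntegralRep.value, hPd, hPi, Beukers.volume_restrict_cube 2]
    have h := integral_fin_nat_prod_eq_prod (𝕜 := ℝ)
      (μ := fun _ : Fin 2 => (volume : Measure ℝ).restrict (Set.Ioo (0:ℝ) 1))
      fun (_ : Fin 2) (t : ℝ) => 1 / ((q:ℝ) - t)
    simp only [Fin.prod_univ_two, one_div_mul_one_div] at h
    beta_reduce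
    rw [h, sq]

end Summit.KontsevichZagierPeriods.HurwitzMicroSectors.NormalFormPrinciple.PiBox.Island
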